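import Literature.NumberTheory.GaloisRepresentations.CrystallineOrdinaryShape
import Literature.NumberTheory.GaloisRepresentations.FramedRepTwist
import Literature.NumberTheory.GaloisRepresentations.SymplecticMultiplier
import Literature.NumberTheory.GaloisRepresentations.OrdinaryTwistedDeterminant
import Literature.NumberTheory.GaloisRepresentations.AbsolutelyIrreducibleReduction
import Literature.Algebra.Polynomial.QDilationCongruence
import HarnessLib

/-!
# Twisting a framed Galois representation by a power of the cyclotomic character

`Proofs` file (theorems only: no definition, no named fact, no instance; D-0026) in topic
`NumberTheory/GaloisRepresentations`.

For a number field `K`, a prime `p`, `ρ : Γ_K →ₜ* GL_n(ℚ̄_p)` (`FramedGaloisRep K (PadicAlgCl p) n`)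
and `k : ℕ`, the twist `ρ ⊗ ε_p^{-k}` is the accepted `FramedRep.twist ρ χ` by the continuous
character `χ = (cyclotomicPadicAlgCl K p ^ k)⁻¹ : Γ_K →ₜ* ℚ̄_pˣ` (accepted `cyclotomicPadicAlgCl`, the
`p`-adic cyclotomic character pushed into `ℚ̄_pˣ`; the group structure on `Γ_K →ₜ* ℚ̄_pˣ` is
Mathlib's).  This file records the four standard transports along such a twist, all folklore
(Serre, *Abelian `ℓ`-adic representations* (1968), Ch. I §1.2: `ε_p` is unramified away from `p`
and `ε_p(Frob_v) = q_v`; Greenberg 1991, §2: ordinary representations), used by the crux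
`SerreGSp4Surjective` (stmt-Langlands-17765, line `singer-type-evaporation`, stub
`stub_ordinaryEndgame`: the cyclotomic-twist glue moving a crystalline-ordinary lift with integer
exponents into an `ℕ`-shape):

* `charpoly_smul_of_ne_zero` — over a field, `charpoly (c • M) = (charpoly M).scaleRoots c` for
  `c ≠ 0` (after the injective substitution `X ↦ cX` both sides are `c^n · charpoly M`;
  `Literature.Algebra.Polynomial.scaleRoots_comp_C_mul_X`), and
  `multiset_prod_X_sub_C_scaleRoots` — `(∏ (X - a)).scaleRoots s = ∏ (X - a s)`;
* `map_units_pow_sub_one_eq_one` — `φ(u^{p-1}) = 1` for `u ∈ ℤ_pˣ` and any ring map `φ` out of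
  `ℤ_p` killing `p` (Fermat in `ℤ_p/p`); `algebraMap_padicInt_mem_valuationSubring` — `ℤ_p` maps
  into `𝒪_{ℚ̄_p} = {‖x‖ ≤ 1}`;
* values of `χ = (cyclotomicPadicAlgCl K p ^ k)⁻¹` (`cycPowInv_apply`, `coe_cycPowInv_apply`,
  `coe_cycPowInv_apply_eq_algebraMap`: `ε_p^{-m(p-1)}(g)` is the image of a `(p-1)`-st power of a
  `p`-adic unit);
* `isCrystallineOrdinaryOfExponents_toLocal_twist` — if `ρ|Γ_{K_v}` is ordinary with cyclotomic
  exponents `b` (accepted `FramedRep.IsCrystallineOrdinaryOfExponents`) then `(ρ ⊗ ε_p^{-k})|Γ_{K_v}`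
  is ordinary with exponents `b - k`, same frame, same unramified characters (`toLocal` of a twist
  is the twist of `toLocal`; scalars are central; `ε_p ∘ res_v = ε_{K_v}`, accepted
  `cyclotomicCharacter_absGaloisRestrict`);
* `isSymplecticWithMultiplierFun_twist` — a twist of a symplectic representation is symplectic
  with multiplier `χ² ν` (same Gram matrix);
* `isUnramifiedAt_twist_cycPowInv` — `ρ ⊗ ε_p^{-k}` is unramified wherever `ρ` is, away from `p`;
* `hasFrobCharpolyAt_twist_cycPowInv` — at `v ∤ p`, the Frobenius polynomial of `ρ ⊗ ε_p^{-k}` is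
  `P.scaleRoots q_v^{-k}` if that of `ρ` is `P`;
* `eventually_natCast_not_mem_asIdeal` — only finitely many places lie above `p`.

## References

* J.-P. Serre, *Abelian ℓ-adic representations and elliptic curves*, Benjamin (1968), Ch. I §1.2
  (Example: the cyclotomic character), §2.3. [SerreAbelianLadic1968]
* R. Greenberg, *Iwasawa theory for motives*, LMS Lecture Note Ser. 153 (1991), §2. [Greenberg1991]
-/

noncomputable section

open Polynomial IsDedekindDomain Field
open scoped NumberField MatrixGroups

namespace Literature.NumberTheory.GaloisRepresentations

/-! ### Characteristic polynomial of a scalar multiple -/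

/-- Composition with `C c * X` is injective on `R[X]` for a unit `c` (compose back with
`C c⁻¹ * X`). [folklore] -/
theorem comp_C_mul_X_injective {R : Type*} [CommRing R] {c : R} (hc : IsUnit c) :
    Function.Injective fun q : R[X] => q.comp (C c * X) := by
  obtain ⟨u, rfl⟩ := hc
  intro q q' h
  have key : ∀ r : R[X], (r.comp (C (u : R) * X)).comp (C ((u⁻¹ : Rˣ) : R) * X) = r := fun r => by
    rw [comp_assoc, mul_comp, C_comp, X_comp, ← mul_assoc, ← C_mul, Units.mul_inv, C_1, one_mul,
      comp_X]
  have h' := congrArg (fun r : R[X] => r.comp (C ((u⁻¹ : Rˣ) : R) * X)) h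
  simpa only [key] using h'

/-- **Characteristic polynomial of a scalar multiple of a matrix** over a field: for `c ≠ 0`,
`charpoly (c • M) = (charpoly M).scaleRoots c` (the eigenvalues are multiplied by `c`).  Proof:
after the injective substitution `X ↦ cX` both sides become `c^n · charpoly M`
(`det (cX - cM) = c^n det (X - M)`; `Literature.Algebra.Polynomial.scaleRoots_comp_C_mul_X`).
[folklore] -/
theorem charpoly_smul_of_ne_zero {F : Type*} [Field F] {n : Type*} [Fintype n] [DecidableEq n]
    {c : F} (hc : c ≠ 0) (M : Matrix n n F) :
    (c • M).charpoly = M.charpoly.scaleRoots c := by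
  apply comp_C_mul_X_injective (isUnit_iff_ne_zero.mpr hc)
  dsimp only
  rw [Literature.Algebra.Polynomial.scaleRoots_comp_C_mul_X, Matrix.charpoly_natDegree_eq_dim]
  have h1 : (c • M).charpoly.comp (C c * X) =
      ((Polynomial.compRingHom (C c * X)).mapMatrix (Matrix.charmatrix (c • M))).det := by
    rw [Matrix.charpoly, ← RingHom.map_det]; rfl
  have h2 : (Polynomial.compRingHom (C c * X)).mapMatrix (Matrix.charmatrix (c • M)) =
      C c • Matrix.charmatrix M := by
    ext i j : 2
    by_cases hij : i = j
    · subst hij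
      simp [Matrix.charmatrix_apply_eq, mul_sub]
    · simp [Matrix.charmatrix_apply_ne _ _ _ hij, smul_eq_mul]
  rw [h1, h2, Matrix.det_smul, Matrix.charpoly, ← C_pow]

/-- Scaling the roots of a split monic: `(∏_{a ∈ m} (X - a)).scaleRoots s = ∏_{a ∈ m} (X - a s)`.
[folklore] -/
theorem multiset_prod_X_sub_C_scaleRoots {R : Type*} [CommRing R] [NoZeroDivisors R]
    (m : Multiset R) (s : R) :
    ((m.map fun a => X - C a).prod).scaleRoots s = (m.map fun a => X - C (a * s)).prod := by
  induction m using Multiset.induction_on with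
  | empty => simp
  | cons a m ih =>
    rw [Multiset.map_cons, Multiset.prod_cons, mul_scaleRoots_of_noZeroDivisors, X_sub_C_scaleRoots,
      ih, Multiset.map_cons, Multiset.prod_cons]

/-! ### Maps out of `ℤ_p` killing `p`; `ℤ_p ⊆ 𝒪_{ℚ̄_p}` -/

/-- For a unit `u ∈ ℤ_pˣ` and any ring homomorphism `φ : ℤ_p → F` with `p = 0` in `F`,
`φ(u^{p-1}) = 1`: `u^{p-1} ≡ 1 (mod p)` (Fermat in `ℤ_p/p = 𝔽_p`), i.e. `u^{p-1} = 1 + pt`.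
[folklore] -/
theorem map_units_pow_sub_one_eq_one {p : ℕ} [Fact p.Prime] {F : Type*} [CommRing F]
    (φ : ℤ_[p] →+* F) (hp : (p : F) = 0) (u : ℤ_[p]ˣ) : φ ((u : ℤ_[p]) ^ (p - 1)) = 1 := by
  have h1 : PadicInt.toZMod ((u : ℤ_[p]) ^ (p - 1)) = 1 := by
    rw [map_pow]
    exact ZMod.pow_card_sub_one_eq_one ((Units.isUnit u).map PadicInt.toZMod).ne_zero
  have h2 : (u : ℤ_[p]) ^ (p - 1) - 1 ∈ IsLocalRing.maximalIdeal ℤ_[p] := by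
    rw [← PadicInt.ker_toZMod, RingHom.mem_ker, map_sub, h1, map_one, sub_self]
  rw [PadicInt.maximalIdeal_eq_span_p, Ideal.mem_span_singleton'] at h2
  obtain ⟨t, ht⟩ := h2
  have h3 : (u : ℤ_[p]) ^ (p - 1) = t * p + 1 := by rw [ht, sub_add_cancel]
  rw [h3, map_add, map_mul, map_natCast, hp, mul_zero, zero_add, map_one]

/-- `ℤ_p` maps into the valuation ring `𝒪_{ℚ̄_p} = {‖x‖ ≤ 1}` of `ℚ̄_p`. [folklore] -/
theorem algebraMap_padicInt_mem_valuationSubring {p : ℕ} [Fact p.Prime] (x : ℤ_[p]) :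
    algebraMap ℤ_[p] (PadicAlgCl p) x ∈
      (Valued.v : Valuation (PadicAlgCl p) NNReal).valuationSubring := by
  rw [padicAlgCl_mem_valuationSubring_iff, IsScalarTower.algebraMap_apply ℤ_[p] ℚ_[p] (PadicAlgCl p),
    PadicInt.algebraMap_apply]
  change ‖((x : ℚ_[p]) : PadicAlgCl p)‖ ≤ 1
  rw [PadicAlgCl.norm_extends]
  exact PadicInt.norm_le_one x

/-! ### The character `ε_p^{-k} = (cyclotomicPadicAlgCl K p ^ k)⁻¹` -/

section CycPow

variable {K : Type} [Field K] {p : ℕ} [Fact p.Prime]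

/-- Values of `(cyclotomicPadicAlgCl K p ^ k)⁻¹` in `ℚ̄_pˣ`: `g ↦ (ε_p(g)^k)⁻¹`. [folklore] -/
theorem cycPowInv_apply (k : ℕ) (g : absoluteGaloisGroup K) :
    ((cyclotomicPadicAlgCl K p ^ k)⁻¹ : absoluteGaloisGroup K →ₜ* (PadicAlgCl p)ˣ) g =
      ((cyclotomicPadicAlgCl K p g) ^ k)⁻¹ := by
  change ((cyclotomicPadicAlgCl K p ^ k) g)⁻¹ = _
  rw [ContinuousMonoidHom.pow_apply]

/-- Values of `(cyclotomicPadicAlgCl K p ^ k)⁻¹` in `ℚ̄_p`. [folklore] -/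
theorem coe_cycPowInv_apply (k : ℕ) (g : absoluteGaloisGroup K) :
    (((cyclotomicPadicAlgCl K p ^ k)⁻¹ : absoluteGaloisGroup K →ₜ* (PadicAlgCl p)ˣ) g :
        PadicAlgCl p) = ((cyclotomicPadicAlgCl K p g : PadicAlgCl p) ^ k)⁻¹ := by
  rw [cycPowInv_apply, Units.val_inv_eq_inv_val, Units.val_pow_eq_pow_val]

/-- The value of `ε_p^{-m(p-1)}` at `g` is the image in `ℚ̄_p` of `((ε_p(g)⁻¹)^m)^{p-1} ∈ ℤ_p`, a
`(p-1)`-st power of a `p`-adic unit. [folklore] -/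
theorem coe_cycPowInv_apply_eq_algebraMap (m : ℕ) (g : absoluteGaloisGroup K) :
    (((cyclotomicPadicAlgCl K p ^ (m * (p - 1)))⁻¹ : absoluteGaloisGroup K →ₜ* (PadicAlgCl p)ˣ) g :
        PadicAlgCl p) =
      algebraMap ℤ_[p] (PadicAlgCl p)
        (((((GaloisRep.cyclotomicCharacter K p g)⁻¹ ^ m : ℤ_[p]ˣ) : ℤ_[p])) ^ (p - 1)) := by
  have hc : (cyclotomicPadicAlgCl K p g : PadicAlgCl p) =
      algebraMap ℤ_[p] (PadicAlgCl p) (GaloisRep.cyclotomicCharacter K p g : ℤ_[p]) := rfl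
  rw [coe_cycPowInv_apply, hc, map_pow, Units.val_pow_eq_pow_val, map_pow, ← pow_mul, map_units_inv,
    inv_pow]

end CycPow

/-! ### The four transports along `ρ ↦ ρ ⊗ ε_p^{-k}` -/

section TwistTransport

variable {K : Type} [Field K] [NumberField K] {p : ℕ} [Fact p.Prime] {n : ℕ}

/-- **Ordinary exponents shift under a cyclotomic twist**: if `ρ|Γ_{K_v}` is ordinary with
cyclotomic exponents `b` (`IsCrystallineOrdinaryOfExponents`: triangular frame `g`, unramified
`ψ_i`, diagonal `ψ_i ε^{b_i}`), then `(ρ ⊗ ε_p^{-k})|Γ_{K_v}` is ordinary with exponents `b - k` in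
the same frame with the same `ψ_i` — `toLocal` of a twist is the twist of `toLocal`, scalars are
central (`FramedRep.conj_twist_apply`), and the global cyclotomic character restricts to the local
one (`cyclotomicCharacter_absGaloisRestrict`). [folklore] -/
theorem isCrystallineOrdinaryOfExponents_toLocal_twist (ρ : FramedGaloisRep K (PadicAlgCl p) n)
    (v : HeightOneSpectrum (𝓞 K)) {b : Fin n → ℤ} (k : ℕ)
    (h : FramedRep.IsCrystallineOrdinaryOfExponents p (ρ.toLocal v) b) :
    FramedRep.IsCrystallineOrdinaryOfExponents p
      (FramedGaloisRep.toLocal v (FramedRep.twist ρ ((cyclotomicPadicAlgCl K p ^ k)⁻¹)))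
      (fun i => b i - k) := by
  haveI : NeZero (p : K) := ⟨Nat.cast_ne_zero.mpr (Fact.out : p.Prime).ne_zero⟩
  obtain ⟨g, ψ, hψ, htri, hdiag⟩ := h
  set χ : absoluteGaloisGroup K →ₜ* (PadicAlgCl p)ˣ := (cyclotomicPadicAlgCl K p ^ k)⁻¹ with hχdef
  -- the conjugated twisted local representation, entrywise
  have keyval : ∀ (σ : absoluteGaloisGroup (v.adicCompletion K)) (i j : Fin n),
      ((((FramedGaloisRep.toLocal v (FramedRep.twist ρ χ)).conj g) σ : GL (Fin n) (PadicAlgCl p)) :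
          Matrix (Fin n) (Fin n) (PadicAlgCl p)) i j =
        (χ (absGaloisRestrict K (v.adicCompletion K) σ) : PadicAlgCl p) *
          ((((ρ.toLocal v).conj g) σ : GL (Fin n) (PadicAlgCl p)) :
            Matrix (Fin n) (Fin n) (PadicAlgCl p)) i j := fun σ i j => by
    rw [FramedRep.conj_apply, FramedGaloisRep.toLocal_apply, FramedRep.conj_twist_apply,
      FramedRep.conj_apply, FramedGaloisRep.toLocal_apply, Units.val_mul, FramedRep.coe_scalar_apply,
      ← Algebra.smul_def, Matrix.smul_apply, smul_eq_mul]
  -- the twisting scalar on `Γ_{K_v}` is `ε_{K_v}^{-k}`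
  have hχv : ∀ σ : absoluteGaloisGroup (v.adicCompletion K),
      (χ (absGaloisRestrict K (v.adicCompletion K) σ) : PadicAlgCl p) =
        ((((Units.map (algebraMap ℤ_[p] (PadicAlgCl p)).toMonoidHom
            (GaloisRep.cyclotomicCharacter (v.adicCompletion K) p σ)) ^ k)⁻¹ : (PadicAlgCl p)ˣ) :
          PadicAlgCl p) := fun σ => by
    rw [hχdef, coe_cycPowInv_apply, coe_cyclotomicPadicAlgCl_apply, cyclotomicCharacter_absGaloisRestrict,
      Units.val_inv_eq_inv_val, Units.val_pow_eq_pow_val, val_unitsMap_algebraMap_padicAlgCl]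
  refine ⟨g, ψ, hψ, fun σ i j hij => ?_, fun σ i => ?_⟩
  · rw [keyval, htri σ i j hij, mul_zero]
  · rw [FramedRep.diagEntry_apply, keyval, ← FramedRep.diagEntry_apply, hdiag σ i, hχv, zpow_sub,
      zpow_natCast, Units.val_mul, Units.val_inv_eq_inv_val]
    ring

omit [NumberField K] [Fact p.Prime] in
/-- **A twist of a symplectic representation is symplectic** (same Gram matrix, multiplier
`χ² ν`). [folklore] -/
theorem isSymplecticWithMultiplierFun_twist {A : Type*} [CommRing A] [TopologicalSpace A]
    [IsTopologicalRing A] (ρ : FramedGaloisRep K A n) {ν : absoluteGaloisGroup K → A}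
    (h : ρ.IsSymplecticWithMultiplierFun ν) (χ : absoluteGaloisGroup K →ₜ* Aˣ) :
    FramedGaloisRep.IsSymplecticWithMultiplierFun (FramedRep.twist ρ χ)
      (fun g => (χ g : A) ^ 2 * ν g) := by
  obtain ⟨J, hJ, hdet, hJg⟩ := h
  refine ⟨J, hJ, hdet, fun g => ?_⟩
  show _ = ((χ g : A) ^ 2 * ν g) • J
  rw [FramedRep.coe_twist_apply, Matrix.transpose_smul, Matrix.smul_mul, Matrix.smul_mul,
    Matrix.mul_smul, hJg g, smul_smul, smul_smul, pow_two]

/-- **`ρ ⊗ ε_p^{-k}` is unramified wherever `ρ` is, away from `p`** (the cyclotomic character is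
unramified away from `p`, `FramedGaloisRep.isUnramifiedAt_cyclotomic_holds`).
[cite: SerreAbelianLadic1968, Ch. I §1.2 (Example: the cyclotomic character)] -/
theorem isUnramifiedAt_twist_cycPowInv (ρ : FramedGaloisRep K (PadicAlgCl p) n)
    {v : HeightOneSpectrum (𝓞 K)} (hv : (p : 𝓞 K) ∉ v.asIdeal) (h : ρ.IsUnramifiedAt v) (k : ℕ) :
    FramedGaloisRep.IsUnramifiedAt v (FramedRep.twist ρ ((cyclotomicPadicAlgCl K p ^ k)⁻¹)) := by
  intro 𝔓 h𝔓 σ hσ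
  have h1 : ρ σ = 1 := h 𝔓 h𝔓 σ hσ
  have h2 : GaloisRep.cyclotomicCharacter K p σ = 1 := by
    have h' := FramedGaloisRep.det_cyclotomic_apply K p σ
    rw [FramedRep.det_apply, FramedGaloisRep.isUnramifiedAt_cyclotomic_holds K p hv 𝔓 h𝔓 σ hσ,
      map_one] at h'
    exact h'.symm
  have h3 : cyclotomicPadicAlgCl K p σ = 1 := by
    ext
    rw [coe_cyclotomicPadicAlgCl_apply, h2, Units.val_one, PadicInt.coe_one, map_one, Units.val_one]
  rw [FramedRep.twist_apply, h1, mul_one, cycPowInv_apply, h3, one_pow, inv_one, map_one]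

/-- **Frobenius polynomials of `ρ ⊗ ε_p^{-k}`**: at a place `v ∤ p` where `ρ` has Frobenius
polynomial `P`, the twist has Frobenius polynomial `P.scaleRoots q_v^{-k}` (`ε_p(Frob_v) = q_v`,
`GaloisRep.cyclotomicCharacter_apply_of_isArithFrobAt`; `charpoly_smul_of_ne_zero`).
[cite: SerreAbelianLadic1968, Ch. I §1.2 (Example: the cyclotomic character)] -/
theorem hasFrobCharpolyAt_twist_cycPowInv (ρ : FramedGaloisRep K (PadicAlgCl p) n)
    {v : HeightOneSpectrum (𝓞 K)} (hv : (p : 𝓞 K) ∉ v.asIdeal) {P : (PadicAlgCl p)[X]}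
    (h : ρ.HasFrobCharpolyAt v P) (k : ℕ) :
    FramedGaloisRep.HasFrobCharpolyAt v (P.scaleRoots (((v.residueCard : PadicAlgCl p) ^ k)⁻¹))
      (FramedRep.twist ρ ((cyclotomicPadicAlgCl K p ^ k)⁻¹)) := by
  intro 𝔓 h𝔓 σ hσ
  have hc : ((cyclotomicPadicAlgCl K p σ : (PadicAlgCl p)ˣ) : PadicAlgCl p) = v.residueCard := by
    rw [coe_cyclotomicPadicAlgCl_apply, GaloisRep.cyclotomicCharacter_apply_of_isArithFrobAt hv h𝔓 hσ,
      PadicInt.coe_natCast, map_natCast]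
  have hP : FramedRep.charpoly ρ σ = P := h 𝔓 h𝔓 σ hσ
  unfold FramedRep.charpoly at hP ⊢
  rw [FramedRep.coe_twist_apply, charpoly_smul_of_ne_zero (Units.ne_zero _), hP, coe_cycPowInv_apply,
    hc]

omit [Fact p.Prime] in
/-- Only finitely many finite places of a number field lie above `p`. [folklore] -/
theorem eventually_natCast_not_mem_asIdeal (hp : p ≠ 0) :
    ∀ᶠ v : HeightOneSpectrum (𝓞 K) in Filter.cofinite, (p : 𝓞 K) ∉ v.asIdeal := by
  have hI : Ideal.span {(p : 𝓞 K)} ≠ ⊥ := by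
    rw [Ne, Ideal.span_singleton_eq_bot]
    exact_mod_cast hp
  rw [Filter.eventually_cofinite]
  refine (Ideal.finite_factors hI).subset fun v hv => ?_
  simp only [Set.mem_setOf_eq, not_not] at hv ⊢
  exact (Ideal.dvd_span_singleton).mpr hv

end TwistTransport

end Literature.NumberTheory.GaloisRepresentations

end
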